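import Mathlib

/-!
# The bulk column kernel is the Bloch multiplier (kernel #230, lemmaR-A3 §8(m), PLAN §113)

Solo-blind programme, session s90.  Frozen `κ = 0⁺` column problem of LEMMA R⁺, regime (II)
(`ε = 1/(2P|h|) → 0`).  In the lower-triangular SUB-MODEL (back-coupling `N`, `εb`, `εa₀`
dropped; quadrupole datum only) the two read-out channels of the column kernel are
`k̂_I(z) = (3c/4)(Φ(0) - Φ(z))/z`, `k̂_II(z) = c (Ψ(0) - Ψ(z))/z` with the resolvent functionals
`Φ(z) = e_{r2}ᵀ 𝔊_r(z) P 𝔊_s(z) q`, `Ψ(z) = e_{s1}ᵀ 𝔊_s(z) q`, `q = (iα/2)(e₂ - √2 e₀)`,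
where `𝔊_s` is the resolvent of the even streak chain (hopping `h = -i/2`, first bond `√2 h`),
`𝔊_r` that of the roll chain (`J_{m,m-1} = h (m-2)/(m-1)`, `J_{m,m+1} = h (m+2)/(m+1)`, `m ≥ 2`)
and `P` the site identification `s_m ↦ r_m` (`m ≥ 2`).  In the limit `ε → 0⁺`

  `Φ(z) = 2 i α ξ(z)²`,  `Ψ(z) = -α ξ(z)²`,  `k̂⁰_I(z) = 3 i c α ξ(z)`,  `k̂⁰_II(z) = -2 c α ξ(z)`,

`ξ(z) = √(1+z²) - z` the decaying Bloch multiplier of the free chain (`|ξ| = 1` on the band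
`z ∈ i(-1,1)`: the interior plateau `|k̂_I| = 3|cα|`, flat to `10⁻³` in the certified engine data
D105/D107, and `arg k̂_I(iω)/(cα) = arccos ω`; outside the band the P-free flank is the square-root
cusp `3|cα|(ω - √(ω²-1))`, not a logarithm; in time `k⁰(B) = (3i-2) c α J₁(B)/B`).
Mini-engine check (work/edge_s90/exp3.py): `Φ/(2iαξ²) = 1.00000`, `Ψ/(-αξ²) = 1.00000` at
`ε = 1.6e-5` for complex `z`; plateau `3.0000` (exp2.py).

The proof is finite algebra, checked here over `ℂ`:
* §A the quadrupole datum is `-2√2 (1 + J²) δ₀` in the even sector (`h² = -1/4`), and the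
  resolvent identity `(z-J)⁻¹(1+J²) = (1+z²)(z-J)⁻¹ - (z+J)` whose local part lives on the
  roll-free sites `{0, ±1}`; the finite-`ε` correction `(J-D)² = J² - JD - DJ + D²`;
* §B the free Green column `μ^{|m|}/(h(μ⁻¹-μ))`, `z = h(μ + μ⁻¹)`;
* §C the ROLL BLOCH IDENTITY `(z - J_rr)[m μ^m]_{m≥2} = (2h(1-μ²)/μ)[μ^m]_{m≥2}` (boundary row
  included because `J_{2,1} ∝ (m-2) = 0`), hence `e₂ᵀ 𝔊_r(z)[μ^m] = μ³/(h(1-μ²))`;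
* §D the assembly with `s² = 1 + z²`, `ξ = s - z`, `μ = -iξ`, `h = -i/2`:
  `h(μ⁻¹ - μ) = s`, `μ/(h(1-μ²)) = 1/s`, `Φ = 2iαξ²`, `Ψ = -αξ²`, and the two kernels.
-/

namespace Summit.AnomalousDissipation.AnomalousDissipation.Theorems

open Complex

/-! ## §A  The quadrupole datum and the resolvent identity -/

/-- `(1 + J²)δ₀ = (1 + 2h²)δ₀ + h²(δ₂ + δ₋₂)` has coefficients `1/2` and `-1/4` at `h = ∓ i/2`. -/
theorem bulkBloch_hsq (σ : ℝ) (hσ : σ = 1 ∨ σ = -1) :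
    ((I * σ / 2) ^ 2 : ℂ) = -1/4 ∧ (1 + 2 * (I * σ / 2) ^ 2 : ℂ) = 1/2 := by
  have hs : (σ : ℂ) ^ 2 = 1 := by
    rcases hσ with h | h <;> simp [h]
  have h1 : ((I * σ / 2) ^ 2 : ℂ) = -1/4 := by
    rw [div_pow, mul_pow, I_sq, hs]; norm_num
  exact ⟨h1, by rw [h1]; norm_num⟩

/-- Even-sector coordinates: `e₀ = δ₀`, `e₂ = (δ₂ + δ₋₂)/√2`, so `(1+J²)δ₀ = ½ e₀ - (√2/4) e₂` and the
quadrupole datum `e₂ - √2 e₀ = -2√2 · (1 + J²)δ₀` (coefficient check on `e₀` and on `e₂`). -/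
theorem bulkBloch_quadrupole_coeffs :
    (-2 * Real.sqrt 2 * (1/2 : ℝ) = -Real.sqrt 2) ∧ (-2 * Real.sqrt 2 * (-(Real.sqrt 2 / 4)) = 1)
      ∧ (-(1/4 : ℝ)) * 2 / Real.sqrt 2 = -(Real.sqrt 2 / 4) := by
  have h2 : Real.sqrt 2 * Real.sqrt 2 = 2 := Real.mul_self_sqrt (by norm_num)
  have hpos : 0 < Real.sqrt 2 := Real.sqrt_pos.mpr (by norm_num)
  refine ⟨by ring, by nlinarith [h2], ?_⟩
  field_simp
  nlinarith [h2]

/-- The resolvent identity behind `𝔊(z)(1+J²)δ₀ = (1+z²)𝔊(z)δ₀ - (z+J)δ₀`: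
`1 + J² = (1 + z²) - (z - J)(z + J)` for a scalar `z` (commuting with `J`). -/
theorem bulkBloch_resolvent_identity {R : Type*} [Ring R] (J z : R) (hz : z * J = J * z) :
    (1 : R) + J ^ 2 = (1 + z ^ 2) - (z - J) * (z + J) := by
  have : (z - J) * (z + J) = z ^ 2 - J ^ 2 := by
    rw [sub_mul, mul_add, mul_add, hz, sq, sq]; abel
  rw [this]; abel

/-- Finite-`ε` version: with absorption `D` (diagonal, `D δ₀ = 0`) and `J_free = J - D`,
`J_free² = J² - J D - D J + D²`; applied to `δ₀` only `-D J δ₀ = ε K₀ h (δ₁ + δ₋₁)` survives. -/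
theorem bulkBloch_absorption_square {R : Type*} [Ring R] (J D : R) :
    (J - D) ^ 2 = J ^ 2 - J * D - D * J + D ^ 2 := by
  simp only [sq]; noncomm_ring

/-! ## §B  The free Green column -/

/-- Bloch relation `z = h(μ + μ⁻¹)` in polynomial form and the bulk rows of `(z - J) μ^{|m|} = 0`. -/
theorem bulkBloch_free_bulk_row (h μ z : ℂ) (m : ℕ) (hz : z * μ = h * (μ ^ 2 + 1)) :
    z * μ ^ (m + 1) - h * (μ ^ m + μ ^ (m + 2)) = 0 := by
  have : z * μ ^ (m + 1) = (z * μ) * μ ^ m := by ring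
  rw [this, hz]; ring

/-- Boundary row at the origin of the doubly infinite free chain: `z·1 - h(μ + μ) = h(μ⁻¹ - μ)`,
so `G₀₀(z) = 1/(h(μ⁻¹ - μ))` and `G_{m0} = μ^{|m|} G₀₀`. -/
theorem bulkBloch_free_origin_row (h μ z : ℂ) (hμ : μ ≠ 0) (hz : z * μ = h * (μ ^ 2 + 1)) :
    z * 1 - h * (μ + μ) = h * (μ⁻¹ - μ) := by
  have hz' : z = h * (μ ^ 2 + 1) / μ := by field_simp; linear_combination hz
  rw [hz']; field_simp; ring

/-! ## §C  The roll Bloch identity -/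

/-- ROLL BLOCH IDENTITY (ring form, any `m`): with `z μ = h(μ²+1)`,
`z (m μ^{m+1}) - h((m-2) μ^m + (m+2) μ^{m+2}) = 2h(1-μ²) μ^m`. -/
theorem bulkBloch_roll_identity_ring (h μ z : ℂ) (m : ℂ) (n : ℕ)
    (hz : z * μ = h * (μ ^ 2 + 1)) :
    z * (m * μ ^ (n + 1)) - h * ((m - 2) * μ ^ n + (m + 2) * μ ^ (n + 2))
      = 2 * h * (1 - μ ^ 2) * μ ^ n := by
  have : z * (m * μ ^ (n + 1)) = m * (z * μ) * μ ^ n := by ring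
  rw [this, hz]; ring

/-- ROLL BLOCH IDENTITY (matrix form): for the roll row `m = n + 1 ≥ 2` the operator
`z u_m - h((m-2)/(m-1) u_{m-1} + (m+2)/(m+1) u_{m+1})` applied to `u_m = m μ^m` gives
`2h(1-μ²) μ^{m-1}` — including the boundary row `m = 2`, where the coefficient `(m-2)` vanishes. -/
theorem bulkBloch_roll_identity (h μ z : ℂ) (n : ℕ) (hn : 1 ≤ n)
    (hz : z * μ = h * (μ ^ 2 + 1)) :
    z * (((n : ℂ) + 1) * μ ^ (n + 1))
      - h * ((((n : ℂ) + 1) - 2) / (((n : ℂ) + 1) - 1) * ((n : ℂ) * μ ^ n)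
             + (((n : ℂ) + 1) + 2) / (((n : ℂ) + 1) + 1) * (((n : ℂ) + 2) * μ ^ (n + 2)))
      = 2 * h * (1 - μ ^ 2) * μ ^ n := by
  have hn0 : (n : ℂ) ≠ 0 := by exact_mod_cast (show n ≠ 0 by omega)
  have hn2 : (n : ℂ) + 2 ≠ 0 := by
    have : ((n + 2 : ℕ) : ℂ) ≠ 0 := by exact_mod_cast (show n + 2 ≠ 0 by omega)
    push_cast at this; exact this
  have e1 : (((n : ℂ) + 1) - 2) / (((n : ℂ) + 1) - 1) * ((n : ℂ) * μ ^ n)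
      = (((n : ℂ) + 1) - 2) * μ ^ n := by
    rw [show ((n : ℂ) + 1) - 1 = n by ring, ← mul_assoc, div_mul_cancel₀ _ hn0]
  have e2 : (((n : ℂ) + 1) + 2) / (((n : ℂ) + 1) + 1) * (((n : ℂ) + 2) * μ ^ (n + 2))
      = (((n : ℂ) + 1) + 2) * μ ^ (n + 2) := by
    rw [show ((n : ℂ) + 1) + 1 = n + 2 by ring, ← mul_assoc, div_mul_cancel₀ _ hn2]
  rw [e1, e2]
  exact bulkBloch_roll_identity_ring h μ z ((n : ℂ) + 1) n hz

/-- Hence `u_m := m μ^{m+1} / (2h(1-μ²))` solves `(z - J_rr) u = (μ^m)_{m ≥ 2}` row by row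
(`m = n + 1`, `n ≥ 1`), and the read-out row gives `e₂ᵀ 𝔊_r(z) [μ^m] = u_2 = μ³/(h(1-μ²))`. -/
theorem bulkBloch_roll_solution (h μ z : ℂ) (n : ℕ) (hn : 1 ≤ n) (hh : h ≠ 0) (hμ : 1 - μ ^ 2 ≠ 0)
    (hz : z * μ = h * (μ ^ 2 + 1)) :
    z * ((((n : ℂ) + 1) * μ ^ (n + 2)) / (2 * h * (1 - μ ^ 2)))
      - h * ((((n : ℂ) + 1) - 2) / (((n : ℂ) + 1) - 1) * (((n : ℂ) * μ ^ (n + 1)) / (2 * h * (1 - μ ^ 2)))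
             + (((n : ℂ) + 1) + 2) / (((n : ℂ) + 1) + 1) * ((((n : ℂ) + 2) * μ ^ (n + 3)) / (2 * h * (1 - μ ^ 2))))
      = μ ^ (n + 1)
    ∧ ((2 : ℂ) * μ ^ 3) / (2 * h * (1 - μ ^ 2)) = μ ^ 3 / (h * (1 - μ ^ 2)) := by
  have hD : (2 : ℂ) * h * (1 - μ ^ 2) ≠ 0 := mul_ne_zero (mul_ne_zero two_ne_zero hh) hμ
  have key := bulkBloch_roll_identity h μ z n hn hz
  constructor
  · -- the row identity is `key · μ / (2h(1-μ²))`
    have e : z * ((((n : ℂ) + 1) * μ ^ (n + 2)) / (2 * h * (1 - μ ^ 2)))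
        - h * ((((n : ℂ) + 1) - 2) / (((n : ℂ) + 1) - 1) * (((n : ℂ) * μ ^ (n + 1)) / (2 * h * (1 - μ ^ 2)))
             + (((n : ℂ) + 1) + 2) / (((n : ℂ) + 1) + 1) * ((((n : ℂ) + 2) * μ ^ (n + 3)) / (2 * h * (1 - μ ^ 2))))
        = (z * (((n : ℂ) + 1) * μ ^ (n + 1))
            - h * ((((n : ℂ) + 1) - 2) / (((n : ℂ) + 1) - 1) * ((n : ℂ) * μ ^ n)
              + (((n : ℂ) + 1) + 2) / (((n : ℂ) + 1) + 1) * (((n : ℂ) + 2) * μ ^ (n + 2)))) * μ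
            / (2 * h * (1 - μ ^ 2)) := by
      field_simp
      ring
    rw [e, key]
    field_simp
    ring
  · field_simp

/-! ## §D  Assembly: `Φ = 2iαξ²`, `Ψ = -αξ²`, `k̂⁰_I = 3icαξ`, `k̂⁰_II = -2cαξ` -/

/-- The Bloch multiplier relations: `s² = 1 + z²`, `ξ = s - z` give `ξ² + 2zξ - 1 = 0`,
`1 + ξ² = 2sξ`, `1 - ξ² = 2zξ`. -/
theorem bulkBloch_xi_relations (s z ξ : ℂ) (hs : s ^ 2 = 1 + z ^ 2) (hξ : ξ = s - z) :
    ξ ^ 2 + 2 * z * ξ - 1 = 0 ∧ 1 + ξ ^ 2 = 2 * s * ξ ∧ 1 - ξ ^ 2 = 2 * z * ξ := by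
  subst hξ
  exact ⟨by linear_combination hs, by linear_combination (-1 : ℂ) * hs, by linear_combination (-1 : ℂ) * hs⟩

/-- With `h = -i/2` and `μ = -iξ` the Bloch relation `zμ = h(μ²+1)` holds, the free diagonal Green
function is `G₀₀ = 1/(h(μ⁻¹ - μ)) = 1/s`, and the roll read-out against the streak Bloch wave is
`μ/(h(1-μ²)) = 1/s` (the generating function of the roll row equals the free `G₀₀`). -/
theorem bulkBloch_mu_relations (s z ξ : ℂ) (hs : s ^ 2 = 1 + z ^ 2) (hξ : ξ = s - z)
    (hξ0 : ξ ≠ 0) (hs0 : s ≠ 0) :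
    let h : ℂ := -I / 2
    let μ : ℂ := -I * ξ
    z * μ = h * (μ ^ 2 + 1) ∧ h * (μ⁻¹ - μ) = s ∧ μ / (h * (1 - μ ^ 2)) = 1 / s := by
  intro h μ
  obtain ⟨r1, r2, r3⟩ := bulkBloch_xi_relations s z ξ hs hξ
  have hμ2 : μ ^ 2 = -ξ ^ 2 := by
    show (-I * ξ) ^ 2 = -ξ ^ 2
    rw [mul_pow, neg_pow, I_sq]; ring
  have hμ0 : μ ≠ 0 := mul_ne_zero (neg_ne_zero.mpr I_ne_zero) hξ0
  -- the key relation h(1-μ²) = sμ  (= (-i/2)(1+ξ²) = (-i/2)(2sξ) = s(-iξ))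
  have key : h * (1 - μ ^ 2) = s * μ := by
    show -I / 2 * (1 - μ ^ 2) = s * (-I * ξ)
    rw [hμ2]
    linear_combination (-I / 2) * r2
  have hden : h * (1 - μ ^ 2) ≠ 0 := by rw [key]; exact mul_ne_zero hs0 hμ0
  refine ⟨?_, ?_, ?_⟩
  · show z * (-I * ξ) = -I / 2 * ((-I * ξ) ^ 2 + 1)
    have : (-I * ξ) ^ 2 = -ξ ^ 2 := hμ2
    rw [this]
    linear_combination (-I / 2) * r1
  · have : h * (μ⁻¹ - μ) = h * (1 - μ ^ 2) / μ := by
      field_simp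
    rw [this, key, mul_div_assoc, div_self hμ0, mul_one]
  · rw [div_eq_div_iff hden hs0]
    linear_combination (-1 : ℂ) * key

/-- THE BULK CLOSED FORMS.  Feed `= -4 s μ^m` (quadrupole `-2√2(1+z²)` times even-sector column
`√2 μ^m / s`), roll read-out `μ³/(h(1-μ²)) = μ²/s`, hence
`Φ = (iα/2)(-4s)(μ²/s) = 2iαξ²`; and `Ψ = -2iα(sμ - h) = -αξ²`. -/
theorem bulkBloch_Phi_Psi (s z ξ α : ℂ) (m : ℕ) (hs : s ^ 2 = 1 + z ^ 2) (hξ : ξ = s - z)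
    (hs0 : s ≠ 0) :
    let h : ℂ := -I / 2
    let μ : ℂ := -I * ξ
    (I * α / 2) * (-4 * s) * (μ ^ 2 / s) = 2 * I * α * ξ ^ 2
      ∧ -2 * I * α * (s * μ - h) = -α * ξ ^ 2
      ∧ (-2 * Real.sqrt 2 * s ^ 2) * (Real.sqrt 2 * μ ^ m / s) = -4 * s * μ ^ m := by
  intro h μ
  obtain ⟨r1, r2, r3⟩ := bulkBloch_xi_relations s z ξ hs hξ
  have hμ2 : μ ^ 2 = -ξ ^ 2 := by
    show (-I * ξ) ^ 2 = -ξ ^ 2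
    rw [mul_pow, neg_pow, I_sq]; ring
  have h22 : (Real.sqrt 2 : ℂ) * Real.sqrt 2 = 2 := by
    rw [← Complex.ofReal_mul, Real.mul_self_sqrt (by norm_num)]; norm_num
  refine ⟨?_, ?_, ?_⟩
  · rw [hμ2]; field_simp; ring
  · show -2 * I * α * (s * (-I * ξ) - -I / 2) = -α * ξ ^ 2
    have hI : I * I = -1 := by rw [← sq, I_sq]
    linear_combination α * r2 + (α * (2 * s * ξ - 1)) * hI
  · have hs2 : s ^ 2 / s = s := by rw [sq, mul_div_assoc, div_self hs0, mul_one]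
    rw [show (-2 * (Real.sqrt 2 : ℂ) * s ^ 2) * ((Real.sqrt 2 : ℂ) * μ ^ m / s)
          = -2 * ((Real.sqrt 2 : ℂ) * Real.sqrt 2) * μ ^ m * (s ^ 2 / s) by ring, h22, hs2]
    ring

/-- THE KERNELS.  `k̂⁰_I = (3c/4)(Φ(0) - Φ(z))/z = 3icαξ` and `k̂⁰_II = c(Ψ(0) - Ψ(z))/z = -2cαξ`
(`Φ(0) = 2iα`, `Ψ(0) = -α`, i.e. `k_I(0⁺) = (3/2) i c α`, `V_{s1} = -α`), for `z ≠ 0`. -/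
theorem bulkBloch_kernels (s z ξ α c : ℂ) (hs : s ^ 2 = 1 + z ^ 2) (hξ : ξ = s - z) (hz : z ≠ 0) :
    (3 * c / 4) * (2 * I * α - 2 * I * α * ξ ^ 2) / z = 3 * I * c * α * ξ
      ∧ c * (-α - -α * ξ ^ 2) / z = -2 * c * α * ξ := by
  obtain ⟨r1, r2, r3⟩ := bulkBloch_xi_relations s z ξ hs hξ
  constructor
  · rw [show 2 * I * α - 2 * I * α * ξ ^ 2 = 2 * I * α * (1 - ξ ^ 2) by ring, r3]
    field_simp
    ring
  · rw [show -α - -α * ξ ^ 2 = -α * (1 - ξ ^ 2) by ring, r3]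
    field_simp

/-- On the band `z = iω`, `|ω| < 1`: `s = √(1-ω²)` real and `ξ = s - iω` is unimodular, so
`|k̂⁰_I| = 3|cα|` exactly (the interior plateau) and `|k̂⁰_I|² + … `; outside, `ω > 1`,
`ξ = i(√(ω²-1) - ω)` has modulus `ω - √(ω²-1) = 1/(ω + √(ω²-1))` (the square-root cusp flank). -/
theorem bulkBloch_unimodular (ω : ℝ) (hω : ω ^ 2 < 1) :
    Complex.normSq ((Real.sqrt (1 - ω ^ 2) : ℂ) - I * ω) = 1 := by
  have h1 : 0 ≤ 1 - ω ^ 2 := by linarith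
  rw [Complex.normSq_apply]
  simp [Complex.sub_re, Complex.sub_im, Complex.mul_re, Complex.mul_im]
  nlinarith [Real.sq_sqrt h1, Real.sqrt_nonneg (1 - ω ^ 2)]

/-- Outside the band (`ω > 1`) the decaying multiplier has modulus `ω - √(ω²-1) ∈ (0,1)`, the
reciprocal of `ω + √(ω²-1)`: the P-free outer flank `F_out(d) = 3|cα|(1 - √(2d) + d - …)`,
`d = ω - 1` (D107 at `d = .265/.517`: `.2235/.1712` measured, `.2225/.1707` from the formula). -/
theorem bulkBloch_outer_flank (ω : ℝ) (hω : 1 < ω) :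
    (ω - Real.sqrt (ω ^ 2 - 1)) * (ω + Real.sqrt (ω ^ 2 - 1)) = 1
      ∧ 0 < ω - Real.sqrt (ω ^ 2 - 1) ∧ ω - Real.sqrt (ω ^ 2 - 1) < 1 := by
  have h1 : 0 ≤ ω ^ 2 - 1 := by nlinarith
  have hsq := Real.sq_sqrt h1
  have hnn := Real.sqrt_nonneg (ω ^ 2 - 1)
  refine ⟨by nlinarith, ?_, ?_⟩
  · -- √(ω²-1) < ω
    have : Real.sqrt (ω ^ 2 - 1) < ω := by
      rw [show ω = Real.sqrt (ω ^ 2) from (Real.sqrt_sq (by linarith)).symm]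
      rw [Real.sqrt_sq (by linarith)]
      calc Real.sqrt (ω ^ 2 - 1) < Real.sqrt (ω ^ 2) :=
            Real.sqrt_lt_sqrt h1 (by linarith)
        _ = ω := Real.sqrt_sq (by linarith)
    linarith
  · -- ω - 1 < √(ω²-1) since (ω-1)² < ω² - 1 ⟺ 2 - 2ω < 0... i.e. ω > 1
    have : ω - 1 < Real.sqrt (ω ^ 2 - 1) := by
      have h2 : (ω - 1) ^ 2 < ω ^ 2 - 1 := by nlinarith
      calc ω - 1 = Real.sqrt ((ω - 1) ^ 2) := (Real.sqrt_sq (by linarith)).symm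
        _ < Real.sqrt (ω ^ 2 - 1) := Real.sqrt_lt_sqrt (by positivity) h2
    linarith

end Summit.AnomalousDissipation.AnomalousDissipation.Theorems
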